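import Mathlib
import Literature.Analysis.Convexity.AnisotropicPerimeter
import Literature.Analysis.Convexity.AnisotropicPerimeterPolytopeCutoffs
import Literature.Analysis.Convexity.AnisotropicPerimeterPolytopeLowerCutoff
import HarnessLib

/-!
# The patch theorem for the distributional anisotropic perimeter: `P_K(S) = Σ_m h_K(a_m)·area_m`

Topic `Literature/Analysis/Convexity`; namespace `Literature.Analysis.Convexity`.
An ABSTRACT form of the facet formula (Maggi 2012 (20.2) p. 258 / Remark 20.3; Evans–Gariepy Thm 5.16,
polyhedral case), separating the Gauss–Green input from the variational argument.  Let `S ⊆ V` be any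
set in a finite-dimensional real inner product space and suppose its divergence integrals are carried by
finitely many PATCHES: continuous charts `Φ_m : ℝ × ℝ → V`, measurable chart domains `D_m` of finite
measure and vectors `a_m` with

* (divergence identity) `∫_S div η = Σ_m ∫_{D_m} ⟪η(Φ_m y), a_m⟫ dy` for every `η ∈ C¹_c(V; V)`;
* (separation) `Φ_m(D_m) ∩ closure (Φ_{m'}(D_{m'})) = ∅` for `m ≠ m'`.

Then for every compact convex body `K ∋ 0`:
`anisotropicPerimeter K S = ofReal (Σ_m h_K(a_m) · |D_m|)`, `h_K(a) = sup_{y ∈ K} ⟪y, a⟫`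
(`anisotropicPerimeter_eq_facetSum_of_patches`).  `≤` is the pointwise bound `⟪η, a_m⟫ ≤ h_K(a_m)`
(`setIntegral_inner_le_of_mem`); `≥` uses compact cores `C_m ⊆ D_m` of almost full measure (inner
regularity), pairwise separated thickenings of the compact sets `Φ_m(C_m)` (this is where the separation
hypothesis enters), smooth `[0,1]`-cut-offs `χ_m ≡ 1` on `Φ_m(C_m)` (`exists_contDiff_cutoff_Icc`) and
the admissible field `Σ_m χ_m · k_m`, `k_m ∈ K` exposing `h_K(a_m)` — the cut-off technique of
`AnisotropicPerimeterPolytopeFacetFormula.lean` (crystal3d-full eng g5) made chart- and polytope-free.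
Consumers: the facet formula for bounded OPEN convex polytopes and for their finite disjoint unions
(internal facets cancel), line `TexShadow` of stmt-Ventures-19483 / line `PolyDensity` of
stmt-Ventures-19482 (cell `crystal3d-full`).
[cite: Maggi2012, (20.2) p. 258 and Remark 20.3; EvansGariepy2015, Thm 5.16 (Gauss–Green), polyhedral case]
-/

noncomputable section

namespace Literature.Analysis.Convexity

open _root_.MeasureTheory Set
open scoped ENNReal NNReal RealInnerProductSpace Topology
open Literature.MathematicalPhysics.StatisticalMechanics (fieldDivergence)

variable {V : Type*} [NormedAddCommGroup V] [InnerProductSpace ℝ V]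

/-- continuity of `y ↦ ⟪y, a⟫` (named, to pin down the implicit types). [folklore] -/
private theorem continuous_inner_left' (a : V) : Continuous fun y : V => ⟪y, a⟫ :=
  continuous_id.inner continuous_const

/-- A continuous function bounded by `C` is integrable on a measurable set of finite measure
(chart-side plumbing). [cite: EvansGariepy2015, Thm 5.16 (Gauss–Green) — plumbing] -/
theorem integrableOn_of_continuous_of_bound {f : ℝ × ℝ → ℝ} (hf : Continuous f) {C : ℝ}
    (hC : ∀ y, ‖f y‖ ≤ C) {D : Set (ℝ × ℝ)} (hDf : volume D ≠ ⊤) :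
    IntegrableOn f D volume :=
  Measure.integrableOn_of_bounded (M := C) hDf hf.aestronglyMeasurable (Filter.Eventually.of_forall hC)

/-- The support value `h_K(a) = sup_{y ∈ K} ⟪y, a⟫` bounds `⟪k, a⟫` for `k ∈ K` (`K` compact).
[cite: Maggi2012, (20.2) p. 258 — plumbing] -/
theorem inner_le_sSup_of_mem {K : Set V} (hKc : IsCompact K) (a : V) {k : V} (hk : k ∈ K) :
    ⟪k, a⟫ ≤ sSup ((fun y => ⟪y, a⟫) '' K) :=
  le_csSup ((hKc.image (continuous_inner_left' a)).bddAbove) ⟨k, hk, rfl⟩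

/-- `0 ≤ h_K(a)` when `0 ∈ K` (`K` compact). [cite: Maggi2012, (20.2) p. 258 — plumbing] -/
theorem sSup_inner_nonneg {K : Set V} (hKc : IsCompact K) (hK0 : (0 : V) ∈ K) (a : V) :
    0 ≤ sSup ((fun y => ⟪y, a⟫) '' K) := by
  simpa using inner_le_sSup_of_mem hKc a hK0

/-- The support value is ATTAINED on a compact nonempty `K`: `h_K(a) = ⟪k, a⟫` for some `k ∈ K`.
[cite: Maggi2012, (20.2) p. 258 — plumbing] -/
theorem exists_mem_inner_eq_sSup {K : Set V} (hKc : IsCompact K) (hKne : K.Nonempty) (a : V) :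
    ∃ k ∈ K, ⟪k, a⟫ = sSup ((fun y => ⟪y, a⟫) '' K) := by
  obtain ⟨k, hk, hmax⟩ := hKc.exists_isMaxOn hKne (continuous_inner_left' a).continuousOn
  refine ⟨k, hk, ?_⟩
  have hgr : IsGreatest ((fun y => ⟪y, a⟫) '' K) ⟪k, a⟫ := by
    refine ⟨⟨k, hk, rfl⟩, ?_⟩
    rintro _ ⟨y, hy, rfl⟩
    exact hmax hy
  exact (hgr.csSup_eq).symm

/-- **Patch upper bound for one admissible field**: if `η(x) ∈ K` for all `x` then
`∫_{D} ⟪η(Φ y), a⟫ dy ≤ h_K(a) · |D|` (`K` compact, `|D| < ∞`).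
[cite: Maggi2012, (20.2) p. 258 — the inequality `⟪η, ν⟫ ≤ Φ(ν)`] -/
theorem setIntegral_inner_le_of_mem {K : Set V} (hKc : IsCompact K) {η : V → V} (hη : Continuous η)
    (hηK : ∀ x, η x ∈ K) {Φ : ℝ × ℝ → V} (hΦ : Continuous Φ) (a : V) {D : Set (ℝ × ℝ)}
    (hDf : volume D ≠ ⊤) :
    ∫ y in D, ⟪η (Φ y), a⟫ ≤ sSup ((fun y => ⟪y, a⟫) '' K) * (volume D).toReal := by
  have hle : ∀ y, ⟪η (Φ y), a⟫ ≤ sSup ((fun y => ⟪y, a⟫) '' K) :=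
    fun y => inner_le_sSup_of_mem hKc a (hηK _)
  obtain ⟨C, hC⟩ := (hKc.image (continuous_inner_left' a)).isBounded.exists_norm_le
  have hint : IntegrableOn (fun y => ⟪η (Φ y), a⟫) D volume :=
    integrableOn_of_continuous_of_bound ((continuous_inner_left' a).comp' (hη.comp' hΦ)) (C := C)
      (fun y => hC _ ⟨η (Φ y), hηK _, rfl⟩) hDf
  calc ∫ y in D, ⟪η (Φ y), a⟫ ≤ ∫ _ in D, sSup ((fun y => ⟪y, a⟫) '' K) :=
        setIntegral_mono hint (integrableOn_const hDf) hle
    _ = sSup ((fun y => ⟪y, a⟫) '' K) * (volume D).toReal := by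
        rw [setIntegral_const, smul_eq_mul, measureReal_def, mul_comm]

/-- **Separated cut-offs for a finite family of patches.**  Given compact cores `T_m` and closed sets
`G_m ⊇ ⋃_{m' ≠ m} T_{m'}` with `T_m ∩ G_m = ∅`, there are `C¹` compactly supported `χ_m : V → [0,1]`,
`χ_m ≡ 1` on `T_m`, `χ_m ≡ 0` on `G_m`, with `Σ_m χ_m ≤ 1`.
[cite: EvansGariepy2015, Thm 5.16 (Gauss–Green), polyhedral case — plumbing] -/
theorem exists_separated_cutoffs [FiniteDimensional ℝ V] {μ : Type*} (M : Finset μ) (T G : μ → Set V)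
    (hT : ∀ m ∈ M, IsCompact (T m)) (hG : ∀ m ∈ M, IsClosed (G m))
    (hTG : ∀ m ∈ M, Disjoint (T m) (G m)) (hsub : ∀ m ∈ M, ∀ m' ∈ M, m' ≠ m → T m' ⊆ G m) :
    ∃ χ : μ → V → ℝ, (∀ m ∈ M, ContDiff ℝ 1 (χ m)) ∧ (∀ m ∈ M, HasCompactSupport (χ m)) ∧
      (∀ m ∈ M, ∀ x, 0 ≤ χ m x ∧ χ m x ≤ 1) ∧ (∀ x, ∑ m ∈ M, χ m x ≤ 1) ∧
      (∀ m ∈ M, ∀ x ∈ T m, χ m x = 1) ∧ (∀ m ∈ M, ∀ x ∈ G m, χ m x = 0) := by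
  classical
  have hδex : ∀ m, m ∈ M → ∃ δ : ℝ, 0 < δ ∧
      Disjoint (Metric.cthickening δ (T m)) (Metric.cthickening δ (G m)) :=
    fun m hm => (hTG m hm).exists_cthickenings (hT m hm) (hG m hm)
  choose! δ hδpos hδdisj using hδex
  have hχex : ∀ m, m ∈ M → ∃ χ : V → ℝ, ContDiff ℝ 1 χ ∧ HasCompactSupport χ ∧
      tsupport χ ⊆ Metric.thickening (δ m) (T m) ∧ (∀ x ∈ T m, χ x = 1) ∧ ∀ x, 0 ≤ χ x ∧ χ x ≤ 1 :=
    fun m hm => exists_contDiff_cutoff_Icc (hT m hm) Metric.isOpen_thickening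
      (Metric.self_subset_thickening (hδpos m hm) _)
  choose! χ hχ1 hχc hχsupp hχT hχ01 using hχex
  have hsuppc : ∀ m ∈ M, tsupport (χ m) ⊆ Metric.cthickening (δ m) (T m) :=
    fun m hm => (hχsupp m hm).trans (Metric.thickening_subset_cthickening _ _)
  refine ⟨χ, hχ1, hχc, hχ01, ?_, hχT, ?_⟩
  · intro x
    by_cases hex : ∃ m₀ ∈ M, χ m₀ x ≠ 0
    · obtain ⟨m₀, hm₀, hne⟩ := hex
      have hx₀ : x ∈ Metric.cthickening (δ m₀) (T m₀) := hsuppc m₀ hm₀ (subset_tsupport _ hne)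
      have hothers : ∀ m ∈ M, m ≠ m₀ → χ m x = 0 := by
        intro m hm hmm
        by_contra hne'
        have hxm : x ∈ Metric.cthickening (δ m) (T m) := hsuppc m hm (subset_tsupport _ hne')
        rcases le_total (δ m) (δ m₀) with hle | hle
        · have : x ∈ Metric.cthickening (δ m₀) (G m₀) :=
            Metric.cthickening_subset_of_subset _ (hsub m₀ hm₀ m hm hmm)
              (Metric.cthickening_mono hle _ hxm)
          exact Set.disjoint_left.1 (hδdisj m₀ hm₀) hx₀ this
        · have : x ∈ Metric.cthickening (δ m) (G m) :=
            Metric.cthickening_subset_of_subset _ (hsub m hm m₀ hm₀ (Ne.symm hmm))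
              (Metric.cthickening_mono hle _ hx₀)
          exact Set.disjoint_left.1 (hδdisj m hm) hxm this
      rw [Finset.sum_eq_single_of_mem m₀ hm₀ fun m hm hmm => hothers m hm hmm]
      exact (hχ01 m₀ hm₀ x).2
    · have h0 : ∀ m ∈ M, χ m x = 0 := fun m hm => by
        by_contra h; exact hex ⟨m, hm, h⟩
      rw [Finset.sum_eq_zero h0]; exact zero_le_one
  · intro m hm x hx
    have hx' : x ∈ Metric.cthickening (δ m) (G m) := Metric.self_subset_cthickening _ hx
    have hxT : x ∉ tsupport (χ m) := fun h => Set.disjoint_left.1 (hδdisj m hm) (hsuppc m hm h) hx'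
    exact image_eq_zero_of_notMem_tsupport hxT

/-- **The patch theorem for the distributional anisotropic perimeter** (see the module docstring):
given the divergence identity over finitely many separated patches,
`anisotropicPerimeter K S = ofReal (Σ_m h_K(a_m)·|D_m|)` for every compact convex `K ∋ 0`.
[cite: Maggi2012, (20.2) p. 258 and Remark 20.3; EvansGariepy2015, Thm 5.16 (Gauss–Green), polyhedral case] -/
theorem anisotropicPerimeter_eq_facetSum_of_patches [FiniteDimensional ℝ V] [MeasurableSpace V]
    [BorelSpace V] {μ : Type*} (M : Finset μ)
    (Φ : μ → ℝ × ℝ → V) (hΦ : ∀ m ∈ M, Continuous (Φ m))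
    (D : μ → Set (ℝ × ℝ)) (hDm : ∀ m ∈ M, MeasurableSet (D m)) (hDf : ∀ m ∈ M, volume (D m) ≠ ⊤)
    (a : μ → V)
    (hsep : ∀ m ∈ M, ∀ m' ∈ M, m ≠ m' → Disjoint (Φ m '' D m) (closure (Φ m' '' D m')))
    {S : Set V}
    (hdiv : ∀ η : V → V, ContDiff ℝ 1 η → HasCompactSupport η →
      ∫ x in S, fieldDivergence η x = ∑ m ∈ M, ∫ y in D m, ⟪η (Φ m y), a m⟫)
    {K : Set V} (hKc : IsCompact K) (hK : Convex ℝ K) (hK0 : (0 : V) ∈ K) :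
    anisotropicPerimeter K S =
      ENNReal.ofReal (∑ m ∈ M, sSup ((fun y => ⟪y, a m⟫) '' K) * (volume (D m)).toReal) := by
  classical
  set h : μ → ℝ := fun m => sSup ((fun y => ⟪y, a m⟫) '' K) with hh
  have hpos : ∀ m, 0 ≤ h m := fun m => sSup_inner_nonneg hKc hK0 (a m)
  refine le_antisymm ?_ ?_
  · -- upper bound: `⟪η, a_m⟫ ≤ h_K(a_m)` on every patch
    refine anisotropicPerimeter_le_iff.2 fun η hη1 hηc hηK => ?_
    refine ENNReal.ofReal_le_ofReal ?_
    rw [hdiv η hη1 hηc]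
    exact Finset.sum_le_sum fun m hm =>
      setIntegral_inner_le_of_mem hKc hη1.continuous hηK (hΦ m hm) (a m) (hDf m hm)
  · -- lower bound: cut-off fields exposing `h_K(a_m)` on compact cores of the patches
    obtain ⟨kv, hkvK, hkv⟩ : ∃ kv : μ → V, (∀ m, kv m ∈ K) ∧ ∀ m, ⟪kv m, a m⟫ = h m := by
      have := fun m => exists_mem_inner_eq_sSup hKc ⟨0, hK0⟩ (a m)
      choose kv hkvK hkv using this
      exact ⟨kv, hkvK, hkv⟩
    set Hs : ℝ := ∑ m ∈ M, h m with hHs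
    have hHs0 : 0 ≤ Hs := Finset.sum_nonneg fun m _ => hpos m
    refine ENNReal.le_of_forall_pos_le_add fun ε hε _ => ?_
    have hε' : 0 < (ε : ℝ) / (Hs + 1) := div_pos (by exact_mod_cast hε) (by linarith)
    -- compact cores of almost full measure
    have hcore : ∀ m, m ∈ M → ∃ C : Set (ℝ × ℝ), C ⊆ D m ∧ IsCompact C ∧
        volume (D m \ C) < ENNReal.ofReal ((ε : ℝ) / (Hs + 1)) :=
      fun m hm => (hDm m hm).exists_isCompact_sdiff_lt (hDf m hm) (ENNReal.ofReal_pos.2 hε').ne'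
    choose! C hCD hCc hCvol using hcore
    -- the compact patch cores in `V` and the closed union of the OTHER patches
    set T : μ → Set V := fun m => Φ m '' C m with hT
    set G : μ → Set V := fun m => ⋃ m' ∈ M.erase m, closure (Φ m' '' D m') with hG
    have hTc : ∀ m ∈ M, IsCompact (T m) := fun m hm => (hCc m hm).image (hΦ m hm)
    have hGc : ∀ m ∈ M, IsClosed (G m) := fun m _ =>
      isClosed_biUnion_finset fun m' _ => isClosed_closure
    have hTD : ∀ m ∈ M, T m ⊆ Φ m '' D m := fun m hm => Set.image_mono (hCD m hm)
    have hDG : ∀ m ∈ M, ∀ m' ∈ M, m' ≠ m → Φ m' '' D m' ⊆ G m := by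
      intro m hm m' hm' hne x hx
      exact Set.mem_biUnion (Finset.mem_erase.2 ⟨hne, hm'⟩) (subset_closure hx)
    have hTG : ∀ m ∈ M, Disjoint (T m) (G m) := by
      intro m hm
      rw [hG, Set.disjoint_iUnion₂_right]
      intro m' hm'
      obtain ⟨hne, hm'M⟩ := Finset.mem_erase.1 hm'
      exact Disjoint.mono_left (hTD m hm) (hsep m hm m' hm'M (Ne.symm hne))
    have hsubTG : ∀ m ∈ M, ∀ m' ∈ M, m' ≠ m → T m' ⊆ G m :=
      fun m hm m' hm' hne => (hTD m' hm').trans (hDG m hm m' hm' hne)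
    obtain ⟨χ, hχ1, hχc, hχ01, hχs, hχT, hχG⟩ :=
      exists_separated_cutoffs M T G hTc hGc hTG hsubTG
    -- the field `φ = Σ_m χ_m • k_m`
    set φ : V → V := fun x => ∑ m ∈ M, χ m x • kv m with hφ
    have hφ1 : ContDiff ℝ 1 φ := ContDiff.sum fun m hm => (hχ1 m hm).smul contDiff_const
    have hφc : HasCompactSupport φ := by
      have key : ∀ s : Finset μ, s ⊆ M → HasCompactSupport (fun x : V => ∑ m ∈ s, χ m x • kv m) := by
        intro s
        induction s using Finset.induction_on with
        | empty =>
          intro _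
          rw [show (fun x : V => ∑ m ∈ (∅ : Finset μ), χ m x • kv m) = 0 from funext fun x => by simp]
          exact HasCompactSupport.zero
        | insert i s hi ih =>
          intro hsub
          simp_rw [Finset.sum_insert hi]
          refine HasCompactSupport.add ?_ (ih fun j hj => hsub (Finset.mem_insert_of_mem hj))
          exact (hχc i (hsub (Finset.mem_insert_self i s))).smul_right (f' := fun _ => kv i)
      exact key M le_rfl
    have hφK : ∀ x, φ x ∈ K := fun x =>
      subconvex_sum_mem hK hK0 (fun m => χ m x) kv (fun m hm => (hχ01 m hm x).1) (hχs x)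
        fun m _ => hkvK m
    -- on patch `m` the field is `χ_m • k_m`
    have hφon : ∀ m ∈ M, ∀ y ∈ D m, φ (Φ m y) = χ m (Φ m y) • kv m := by
      intro m hm y hy
      rw [hφ]
      simp only
      rw [Finset.sum_eq_single_of_mem m hm]
      intro m' hm' hne
      have hx : Φ m y ∈ G m' := hDG m' hm' m hm (Ne.symm hne) (Set.mem_image_of_mem _ hy)
      rw [hχG m' hm' _ hx, zero_smul]
    -- evaluate the divergence integral of `φ` patch by patch
    have hI : ∀ m ∈ M, ∫ y in D m, ⟪φ (Φ m y), a m⟫ = h m * ∫ y in D m, χ m (Φ m y) := by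
      intro m hm
      rw [← integral_const_mul]
      refine setIntegral_congr_fun (hDm m hm) fun y hy => ?_
      rw [hφon m hm y hy, inner_smul_left, hkv m]
      simp [mul_comm]
    have hIge : ∀ m ∈ M, (volume (D m)).toReal - (ε : ℝ) / (Hs + 1) ≤ ∫ y in D m, χ m (Φ m y) := by
      intro m hm
      have hCfin : volume (C m) ≠ ⊤ := (lt_of_le_of_lt (measure_mono (hCD m hm))
        (lt_top_iff_ne_top.2 (hDf m hm))).ne
      have hsplit : volume (D m) ≤ volume (C m) + volume (D m \ C m) := by
        calc volume (D m) ≤ volume (C m ∪ (D m \ C m)) := measure_mono (fun y hy => by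
                by_cases h : y ∈ C m; exact Or.inl h; exact Or.inr ⟨hy, h⟩)
          _ ≤ volume (C m) + volume (D m \ C m) := measure_union_le _ _
      have h1 : volume (D m) ≤ volume (C m) + ENNReal.ofReal ((ε : ℝ) / (Hs + 1)) :=
        hsplit.trans (add_le_add le_rfl (hCvol m hm).le)
      have h2 := ENNReal.toReal_mono (ENNReal.add_ne_top.2 ⟨hCfin, ENNReal.ofReal_ne_top⟩) h1
      rw [ENNReal.toReal_add hCfin ENNReal.ofReal_ne_top, ENNReal.toReal_ofReal hε'.le] at h2
      -- `|C_m| ≤ ∫_{D_m} χ_m ∘ Φ_m`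
      have hCmeas : MeasurableSet (C m) := (hCc m hm).isClosed.measurableSet
      have hint : IntegrableOn (fun y => χ m (Φ m y)) (D m) volume :=
        integrableOn_of_continuous_of_bound ((hχ1 m hm).continuous.comp' (hΦ m hm)) (C := 1)
          (fun y => by
            rw [Real.norm_eq_abs, abs_le]
            exact ⟨by linarith [(hχ01 m hm (Φ m y)).1], (hχ01 m hm (Φ m y)).2⟩) (hDf m hm)
      have h3 : ∫ y in D m, (C m).indicator (fun _ => (1 : ℝ)) y ≤ ∫ y in D m, χ m (Φ m y) := by
        have hindint : IntegrableOn (fun y => (C m).indicator (fun _ => (1 : ℝ)) y) (D m) volume :=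
          ((integrable_indicator_iff hCmeas).2 (integrableOn_const hCfin)).integrableOn
        refine setIntegral_mono hindint hint fun y => ?_
        by_cases hy : y ∈ C m
        · rw [Set.indicator_of_mem hy, hχT m hm _ (Set.mem_image_of_mem _ hy)]
        · rw [Set.indicator_of_notMem hy]; exact (hχ01 m hm _).1
      have h4 : ∫ y in D m, (C m).indicator (fun _ => (1 : ℝ)) y = (volume (C m)).toReal := by
        rw [setIntegral_indicator hCmeas, Set.inter_eq_self_of_subset_right (hCD m hm),
          setIntegral_const, smul_eq_mul, mul_one, measureReal_def]
      linarith
    -- sum up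
    have hsum : ∑ m ∈ M, h m * (volume (D m)).toReal ≤ (∫ x in S, fieldDivergence φ x) + ε := by
      rw [hdiv φ hφ1 hφc]
      have h1 : ∀ m ∈ M, h m * (volume (D m)).toReal ≤
          (∫ y in D m, ⟪φ (Φ m y), a m⟫) + h m * ((ε : ℝ) / (Hs + 1)) := by
        intro m hm
        rw [hI m hm]
        nlinarith [hpos m, hIge m hm]
      have h2 := Finset.sum_le_sum h1
      rw [Finset.sum_add_distrib, ← Finset.sum_mul] at h2
      have h3 : Hs * ((ε : ℝ) / (Hs + 1)) ≤ ε := by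
        rw [mul_div_assoc', div_le_iff₀ (by linarith)]
        nlinarith [hHs0, (show (0:ℝ) ≤ ε from by exact_mod_cast hε.le)]
      linarith
    calc ENNReal.ofReal (∑ m ∈ M, h m * (volume (D m)).toReal)
        ≤ ENNReal.ofReal ((∫ x in S, fieldDivergence φ x) + ε) := ENNReal.ofReal_le_ofReal hsum
      _ ≤ ENNReal.ofReal (∫ x in S, fieldDivergence φ x) + ENNReal.ofReal ε := ENNReal.ofReal_add_le
      _ ≤ anisotropicPerimeter K S + ε := by
          rw [ENNReal.ofReal_coe_nnreal]
          exact add_le_add (le_anisotropicPerimeter hφ1 hφc hφK) le_rfl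

end Literature.Analysis.Convexity

end
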